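import Summits.BirchSwinnertonDyer.BirchSwinnertonDyer.Theorems.ManinLocalTwoThreeNewformPinningOneHundredEight
import Summits.BirchSwinnertonDyer.BirchSwinnertonDyer.Theorems.ManinLocalTwoThreeNeronSqueezeOneHundredEight
import HarnessLib

/-!
# LEVEL `108 = 2²·3³` COMPLETE: `|c| = 1`, `2 ∤ c`, `3 ∤ c` for EVERY lattice-optimal `X₀(108)`-datum — UNCONDITIONALLY

Cell `bsd-f2-manin`, route `ManinLocalTwoThree`, cruxes C2 `ManinOddAtFour` (stmt-BirchSwinnertonDyer-22967, `2² ∣ 108`) AND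
C3 `ManinPrimeToThreeAtNine` (stmt-BirchSwinnertonDyer-22968, `3² ∣ 108`) — `108` is the first treated level of the charter's `27 ∣ N` cell and
lies in BOTH crux domains; prover seat p1 gen 25; `--supports stmt-BirchSwinnertonDyer-22967` (helper).

ASSEMBLY of two independent halves:
* the NEWFORM PINNING `LevelOneHundredEight.f_apply_eq_phi108` (p1 g24/g25: `η`-basis `B1c…B10c` of `S₂(Γ₀(108))` with kernel-certified
  tables to `q⁶⁰`, column relations, curve-side exclusion by the curve's own recursion + Hasse, eight explicit OLD witnesses, `old ⊓ new = ⊥`):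
  for every elliptic `W/ℚ` and every `X₀(108)`-datum `D`, `⇑D.f = φ₁₀₈ = −2B₁ + 2B₂ + B₃ + 6B₄ + 6B₅`;
* the NÉRON SQUEEZE `NeronSqueezeOneHundredEight.maninConstant_oneHundredEight_of_pinning` (p3 g24: (S2)₁₀₈ `Λ(φ₁₀₈) ⊆ Λ(0, −16)` by the
  E₂ road, `N(108a1) = 108` by kernel Tate certificates, the general squeeze), which took exactly that pinning as its hypothesis `hpin`.

RESULTS (no hypothesis beyond the datum and its lattice clause; standard axioms): `abs_maninConstant_eq_one_oneHundredEight` (`|c| = 1`),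
`not_two_dvd_maninConstant_oneHundredEight` (the C2 body at `N = 108`), `not_three_dvd_maninConstant_oneHundredEight` (the C3 body at
`N = 108`), `not_prime_dvd_maninConstant_oneHundredEight`, and the two crux SHAPES restricted to `N = 108` with their printed-fact binders
left unused (`maninOddAtFour_oneHundredEight`, `maninPrimeToThreeAtNine_oneHundredEight`).

HONEST FRAMING: this settles Manin's conjecture on the `X₀(108)`-domain of the tree's rendering (every lattice-optimal datum of every
globally minimal elliptic curve at level `108`), fact-free.  The `∀ N` cruxes C2/C3 stay OPEN as filed (⟸ CDT); Manin's conjecture in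
general and BSD are NOT proved by this file.
[cite: AgasheRibetStein2006, §§1–2] [cite: CremonaAlgorithms1997, Table 1 (108a1), Table 3 (N = 108)] [cite: EdixhovenManin1991, Prop. 2]
-/

set_option autoImplicit false
-- lint-debt: the directory name repeats the summit name (sibling precedent `ManinLocalTwoThreeManinConstantFiftyTwo.lean`)
set_option linter.dupNamespace false

noncomputable section

open scoped MatrixGroups ModularForm
open CongruenceSubgroup WeierstrassCurve
open Literature.NumberTheory.EllipticCurves Literature.NumberTheory.EllipticCurves.ModularForms

namespace Summit.BirchSwinnertonDyer.BirchSwinnertonDyer.Theorems.ManinLocalTwoThree.ManinConstantOneHundredEight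

open LevelOneHundredEight NeronSqueezeOneHundredEight

/-- **`|c| = 1` on `X₀(108)`, UNCONDITIONALLY**: for every globally minimal elliptic `W/ℚ` and every `X₀(108)`-parametrisation datum `D` of
`W` with the lattice clause `Λ_W = c·Λ(D.f)`. [cite: AgasheRibetStein2006, §§1–2] -/
theorem abs_maninConstant_eq_one_oneHundredEight (W : WeierstrassCurve ℚ) [W.IsElliptic] [W.IsGloballyMinimal]
    (D : ModularParametrizationData W 108) (hopt : ∀ z ∈ D.L.lattice, ∃ w ∈ periodLattice D.f, z = D.c * w) :
    |D.maninConstant| = 1 :=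
  abs_maninConstant_eq_one_oneHundredEight_of_f_eq W D (f_apply_eq_phi108 D) hopt

/-- **`2 ∤ c` on `X₀(108)`, UNCONDITIONALLY** — the body of the crux C2 `ManinOddAtFour` at `N = 108` (`2² ∣ 108`) with none of its fact
hypotheses. [cite: AgasheRibetStein2006, §§1–2] -/
theorem not_two_dvd_maninConstant_oneHundredEight (W : WeierstrassCurve ℚ) [W.IsElliptic] [W.IsGloballyMinimal]
    (D : ModularParametrizationData W 108) (hopt : ∀ z ∈ D.L.lattice, ∃ w ∈ periodLattice D.f, z = D.c * w) :
    ¬ (2 : ℤ) ∣ D.maninConstant :=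
  (not_dvd_maninConstant_oneHundredEight_of_f_eq W D (f_apply_eq_phi108 D) hopt).1

/-- **`3 ∤ c` on `X₀(108)`, UNCONDITIONALLY** — the body of the crux C3 `ManinPrimeToThreeAtNine` at `N = 108` (`3² ∣ 108`) with none of its
fact hypotheses. [cite: AgasheRibetStein2006, §§1–2] -/
theorem not_three_dvd_maninConstant_oneHundredEight (W : WeierstrassCurve ℚ) [W.IsElliptic] [W.IsGloballyMinimal]
    (D : ModularParametrizationData W 108) (hopt : ∀ z ∈ D.L.lattice, ∃ w ∈ periodLattice D.f, z = D.c * w) :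
    ¬ (3 : ℤ) ∣ D.maninConstant :=
  (not_dvd_maninConstant_oneHundredEight_of_f_eq W D (f_apply_eq_phi108 D) hopt).2

/-- **No prime divides `c` on `X₀(108)`.** [cite: AgasheRibetStein2006, §§1–2] -/
theorem not_prime_dvd_maninConstant_oneHundredEight (W : WeierstrassCurve ℚ) [W.IsElliptic] [W.IsGloballyMinimal]
    (D : ModularParametrizationData W 108) (hopt : ∀ z ∈ D.L.lattice, ∃ w ∈ periodLattice D.f, z = D.c * w)
    {p : ℕ} (hp : p.Prime) : ¬ (p : ℤ) ∣ D.maninConstant := by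
  have h := abs_maninConstant_eq_one_oneHundredEight W D hopt
  intro hpd
  have h1 := Int.le_of_dvd (by rw [h]; norm_num) ((dvd_abs _ _).mpr hpd)
  rw [h] at h1
  have := hp.two_le
  omega

/-- p3's conditional package `maninConstant_oneHundredEight_of_pinning` with its pinning hypothesis DISCHARGED: `|c| = 1 ∧ 2 ∤ c ∧ 3 ∤ c` on
`X₀(108)`. [cite: AgasheRibetStein2006, §§1–2] -/
theorem maninConstant_oneHundredEight (W : WeierstrassCurve ℚ) [W.IsElliptic] [W.IsGloballyMinimal]
    (D : ModularParametrizationData W 108) (hopt : ∀ z ∈ D.L.lattice, ∃ w ∈ periodLattice D.f, z = D.c * w) :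
    |D.maninConstant| = 1 ∧ ¬ (2 : ℤ) ∣ D.maninConstant ∧ ¬ (3 : ℤ) ∣ D.maninConstant :=
  maninConstant_oneHundredEight_of_pinning (fun _ _ D' ↦ f_apply_eq_phi108 D') W D hopt

/-- **The C2 shape `ManinOddAtFour` RESTRICTED TO `N = 108`**, binders verbatim (the four printed-fact hypotheses are accepted and left
unused): UNCONDITIONAL.  The `∀ N` crux is NOT proved by this. [cite: AgasheRibetStein2006, §§1–2] -/
theorem maninOddAtFour_oneHundredEight :
    mazur_not_dvd_maninConstant_of_odd → abbesUllmo_not_dvd_maninConstant_of_not_dvd_level →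
    cesnavicius_not_two_dvd_maninConstant_of_two_dvd_level → exists_isNewformOf →
    ∀ (W : WeierstrassCurve ℚ) [W.IsElliptic] [W.IsGloballyMinimal] (D : ModularParametrizationData W 108),
      (∀ z ∈ D.L.lattice, ∃ w ∈ periodLattice D.f, z = D.c * w) → 2 ^ 2 ∣ 108 → ¬ (2 : ℤ) ∣ D.maninConstant :=
  fun _ _ _ _ W _ _ D hopt _ ↦ not_two_dvd_maninConstant_oneHundredEight W D hopt

/-- **The C3 shape `ManinPrimeToThreeAtNine` RESTRICTED TO `N = 108`**, binders verbatim (printed-fact hypotheses unused): UNCONDITIONAL.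
The `∀ N` crux is NOT proved by this. [cite: AgasheRibetStein2006, §§1–2] -/
theorem maninPrimeToThreeAtNine_oneHundredEight :
    mazur_not_dvd_maninConstant_of_odd → abbesUllmo_not_dvd_maninConstant_of_not_dvd_level →
    cesnavicius_not_two_dvd_maninConstant_of_two_dvd_level → exists_isNewformOf →
    ∀ (W : WeierstrassCurve ℚ) [W.IsElliptic] [W.IsGloballyMinimal] (D : ModularParametrizationData W 108),
      (∀ z ∈ D.L.lattice, ∃ w ∈ periodLattice D.f, z = D.c * w) → 3 ^ 2 ∣ 108 → ¬ (3 : ℤ) ∣ D.maninConstant :=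
  fun _ _ _ _ W _ _ D hopt _ ↦ not_three_dvd_maninConstant_oneHundredEight W D hopt

end Summit.BirchSwinnertonDyer.BirchSwinnertonDyer.Theorems.ManinLocalTwoThree.ManinConstantOneHundredEight

end
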